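import Literature.MathematicalPhysics.QuantumLattice.HubbardUniformOneParticleCost
import HarnessLib

/-!
# The Gutzwiller-projected creation operator commutes with the Hubbard repulsion

Topic `MathematicalPhysics/QuantumLattice` (family `hubbard`); proof-only.  Part 1 of the
coupling-independent one-particle costs of the REPULSIVE Hubbard model (part 2:
`HubbardProjectedOneParticleCost`, part 3: `HubbardParityGapCeilingStrongCoupling`), written for route
`HubbardSuperconductivity/ParityGapRigidity` (crux `GappedWindow`, stmt-HubbardSuperconductivity-2196, and
its kill criterion `NoUniformParityGap`, stmt-…-2198).  The tree's one-particle cost bounds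
(`HubbardOneParticleCost`, `HubbardUniformOneParticleCost`, `HubbardBlochModeVariational`) all carry a term
`|U|`; here the `U`-dependence of the ADDITION cost is removed at the operator level.

* `interactionSum_mul_projCreation_sub` — the projected creation operator `(1 - n_{zτ'}) c†_{zτ}`
  (`τ' ≠ τ`; add an electron on a site carrying no opposite spin) COMMUTES with `Σ_x n_{x↑} n_{x↓}`
  (`[Σ n↑n↓, c†_{zτ}] = n_{zτ'} c†_{zτ}` and `(1 - n) n = 0`);
* `norm_commutator_hopping_creation_le`, `…_annihilation_le`, `…_numberOp_le` — the hopping commutators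
  `[H₀, c†_z]`, `[H₀, c_z]`, `[H₀, n_z]` have norms `≤ Δ|t|, Δ|t|, 2Δ|t|` on a graph of maximal degree `≤ Δ`;
* `norm_commutator_hamiltonian_projCreation_le` (`_up_le`) — hence for EVERY real `U`,
  `‖[hamiltonian G t U, (1 - n_{zτ'}) c†_{zτ}]‖ ≤ 3Δ|t|`.

A Summits-side special case of the same device (constant `(2Δ+1)·8|t|` via the Hastings–Koma locality
bound, used for the PAIR chemical potential of crux `NoOnsiteODLRO`) is
`Summits/HubbardSuperconductivity/…/Theorems/LiebTwinNoOnsiteODLROProjectedAddition.lean`; this file is the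
Literature-level statement with the explicit commutators of `HubbardUniformOneParticleCost`.  Everything is
proved; no definitions, no named facts.  Sources: H. Tasaki, *Physics and Mathematics of Quantum Many-Body
Systems* (2020) §9.3 (Hubbard commutators), §11.2 (Gutzwiller projection); F. H. L. Essler et al., *The
One-Dimensional Hubbard Model* (2005) §2.1 eq. (2.8); W. F. Brinkman, T. M. Rice, Phys. Rev. B 2 (1970)
4302, §II.  Folklore finite-dimensional statements.

## Mathlib / tree search

Tree (REUSED): `hamiltonian_mul_creation_sub`, `hamiltonian_mul_annihilation_sub`,
`interactionSum_mul_creation_sub` (`HubbardUniformOneParticleCost`); `numberAt_orb`,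
`numberAt_idempotent`, `numberAt_commute`, `annihilation_mul_creation_add_creation_mul_annihilation_holds`,
`norm_creation_le_one`, `norm_annihilation_le_one`.  Mathlib: `Commute.sum_left`, `Commute.mul_left`,
`norm_sum_le`, `Fin.eq_one_of_ne_zero`, `noncomm_ring`.
-/

noncomputable section

namespace Literature.MathematicalPhysics.QuantumLattice

open Matrix Finset HubbardWave0 ThermodynamicLimit
open scoped ComplexOrder Matrix.Norms.L2Operator InnerProductSpace

variable {Λ : Type*} [LinearOrder Λ] [Fintype Λ] (G : SimpleGraph Λ) [DecidableRel G.Adj]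

/-! ### The projected creation operator commutes with the repulsion -/

/-- The on-site repulsion `Σ_x n_{x↑} n_{x↓}` commutes with every number operator. [folklore] -/
theorem interactionSum_commute_numberOp (z : Λ) (τ : Fin 2) :
    Commute (∑ x : Λ, numberOp x 0 * numberOp x 1 : Matrix (Finset (Orb Λ)) (Finset (Orb Λ)) ℂ)
      (numberOp z τ) := by
  refine Commute.sum_left _ _ _ fun x _ => ?_
  exact Commute.mul_left (numberAt_commute _ _) (numberAt_commute _ _)

/-- `(1 - n) n = 0` for a number operator. [folklore] -/
theorem one_sub_numberOp_mul_numberOp (z : Λ) (τ : Fin 2) :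
    ((1 : Matrix (Finset (Orb Λ)) (Finset (Orb Λ)) ℂ) - numberOp z τ) * numberOp z τ = 0 := by
  rw [sub_mul, one_mul, ← numberAt_orb, (numberAt_idempotent (orb z τ)).eq, sub_self]

/-- **The projected creation operator commutes with the repulsion**: with `τ' ≠ τ` the spin for which
`[Σ_x n_{x↑}n_{x↓}, c†_{zτ}] = n_{zτ'} c†_{zτ}` (`interactionSum_mul_creation_sub`),
`[Σ_x n_{x↑}n_{x↓}, (1 - n_{zτ'}) c†_{zτ}] = (1 - n_{zτ'}) n_{zτ'} c†_{zτ} = 0` — an electron created on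
a site carrying no opposite spin creates no double occupancy. Tasaki (2020) §9.3, §11.2;
Brinkman–Rice (1970) §II. [folklore] -/
theorem interactionSum_mul_projCreation_sub (z : Λ) (τ : Fin 2) :
    ∃ τ' : Fin 2, τ' ≠ τ ∧
      (∑ x : Λ, numberOp x 0 * numberOp x 1) * ((1 - numberOp z τ') * creation (orb z τ)) -
          ((1 - numberOp z τ') * creation (orb z τ)) * (∑ x : Λ, numberOp x 0 * numberOp x 1) =
        (0 : Matrix (Finset (Orb Λ)) (Finset (Orb Λ)) ℂ) := by
  obtain ⟨τ', hτ', hV⟩ := interactionSum_mul_creation_sub (Λ := Λ) z τ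
  refine ⟨τ', hτ', ?_⟩
  set D : Matrix (Finset (Orb Λ)) (Finset (Orb Λ)) ℂ := ∑ x : Λ, numberOp x 0 * numberOp x 1 with hD
  have hcomm : D * (1 - numberOp z τ') = (1 - numberOp z τ') * D := by
    rw [mul_sub, sub_mul, mul_one, one_mul, (interactionSum_commute_numberOp z τ').eq]
  have hV' : D * creation (orb z τ) = creation (orb z τ) * D + numberOp z τ' * creation (orb z τ) :=
    (sub_eq_iff_eq_add'.1 hV)
  calc D * ((1 - numberOp z τ') * creation (orb z τ)) -
        (1 - numberOp z τ') * creation (orb z τ) * D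
      = (1 - numberOp z τ') * (D * creation (orb z τ)) -
          (1 - numberOp z τ') * creation (orb z τ) * D := by rw [← mul_assoc, hcomm, mul_assoc]
    _ = ((1 - numberOp z τ') * numberOp z τ') * creation (orb z τ) := by
          rw [hV', mul_add, mul_assoc, mul_assoc]; abel
    _ = 0 := by rw [one_sub_numberOp_mul_numberOp, zero_mul]

/-! ### Norm bounds for the hopping commutators -/

omit [LinearOrder Λ] in
/-- `‖Σ_{x ∼ z} M_x‖ ≤ Δ` when every `‖M_x‖ ≤ 1`, on a graph of maximal degree `≤ Δ`. [folklore] -/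
theorem norm_sum_ite_adj_le {Δ : ℕ} (hΔ : ∀ x : Λ, #{y | G.Adj x y} ≤ Δ) (z : Λ)
    {m : Type*} [Fintype m] [DecidableEq m] (M : Λ → Matrix m m ℂ) (hM : ∀ x, ‖M x‖ ≤ 1) :
    ‖∑ x : Λ, (if G.Adj x z then M x else 0)‖ ≤ Δ := by
  calc ‖∑ x : Λ, (if G.Adj x z then M x else 0)‖
      ≤ ∑ x : Λ, ‖(if G.Adj x z then M x else 0)‖ := norm_sum_le _ _
    _ = ∑ x ∈ Finset.univ.filter (fun x => G.Adj x z), ‖M x‖ := by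
        rw [Finset.sum_filter]
        refine Finset.sum_congr rfl fun x _ => ?_
        split_ifs <;> simp
    _ ≤ ∑ _x ∈ Finset.univ.filter (fun x => G.Adj x z), (1 : ℝ) := Finset.sum_le_sum fun x _ => hM x
    _ = #{x | G.Adj x z} := by rw [Finset.sum_const, nsmul_eq_mul, mul_one]
    _ = #{x | G.Adj z x} := by
        have : (Finset.univ.filter fun x => G.Adj x z) = Finset.univ.filter fun x => G.Adj z x := by
          ext x
          simp only [Finset.mem_filter, Finset.mem_univ, true_and]
          exact G.adj_comm _ _
        rw [this]
    _ ≤ Δ := by exact_mod_cast hΔ z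

/-- `‖[H₀, c†_{zτ}]‖ ≤ Δ|t|` for the pure hopping Hamiltonian `H₀ = hamiltonian G t 0`
(`[H₀, c†_{zτ}] = -t Σ_{x∼z} c†_{xτ}`). Tasaki (2020) §9.3. [folklore] -/
theorem norm_commutator_hopping_creation_le {Δ : ℕ} (hΔ : ∀ x : Λ, #{y | G.Adj x y} ≤ Δ) (t : ℝ)
    (z : Λ) (τ : Fin 2) :
    ‖hamiltonian G t 0 * creation (orb z τ) - creation (orb z τ) * hamiltonian G t 0‖ ≤ Δ * |t| := by
  classical
  obtain ⟨τ', -, h⟩ := hamiltonian_mul_creation_sub G t 0 z τ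
  rw [h, Complex.ofReal_zero, zero_smul, add_zero]
  refine (norm_smul_le _ _).trans ?_
  rw [norm_neg, Complex.norm_real, Real.norm_eq_abs, mul_comm]
  exact mul_le_mul_of_nonneg_right
    (norm_sum_ite_adj_le G hΔ z _ fun x => norm_creation_le_one _) (abs_nonneg _)

/-- `‖[H₀, c_{zτ}]‖ ≤ Δ|t|` for the pure hopping Hamiltonian (`[H₀, c_{zτ}] = t Σ_{x∼z} c_{xτ}`).
Tasaki (2020) §9.3. [folklore] -/
theorem norm_commutator_hopping_annihilation_le {Δ : ℕ} (hΔ : ∀ x : Λ, #{y | G.Adj x y} ≤ Δ) (t : ℝ)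
    (z : Λ) (τ : Fin 2) :
    ‖hamiltonian G t 0 * annihilation (orb z τ) - annihilation (orb z τ) * hamiltonian G t 0‖ ≤
      Δ * |t| := by
  classical
  obtain ⟨τ', -, h⟩ := hamiltonian_mul_annihilation_sub G t 0 z τ
  rw [h, Complex.ofReal_zero, zero_smul, sub_zero]
  refine (norm_smul_le _ _).trans ?_
  rw [Complex.norm_real, Real.norm_eq_abs, mul_comm]
  exact mul_le_mul_of_nonneg_right
    (norm_sum_ite_adj_le G hΔ z _ fun x => norm_annihilation_le_one _) (abs_nonneg _)

/-- `‖[H₀, n_{zτ}]‖ ≤ 2Δ|t|` (`[H₀, c†c] = [H₀, c†] c + c† [H₀, c]`). Tasaki (2020) §9.3. [folklore] -/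
theorem norm_commutator_hopping_numberOp_le {Δ : ℕ} (hΔ : ∀ x : Λ, #{y | G.Adj x y} ≤ Δ) (t : ℝ)
    (z : Λ) (τ : Fin 2) :
    ‖hamiltonian G t 0 * numberOp z τ - numberOp z τ * hamiltonian G t 0‖ ≤ 2 * Δ * |t| := by
  set H₀ := hamiltonian G t 0
  have hexp : H₀ * numberOp z τ - numberOp z τ * H₀ =
      (H₀ * creation (orb z τ) - creation (orb z τ) * H₀) * annihilation (orb z τ) +
        creation (orb z τ) * (H₀ * annihilation (orb z τ) - annihilation (orb z τ) * H₀) := by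
    rw [numberOp]; noncomm_ring
  rw [hexp]
  calc _ ≤ ‖(H₀ * creation (orb z τ) - creation (orb z τ) * H₀) * annihilation (orb z τ)‖ +
          ‖creation (orb z τ) * (H₀ * annihilation (orb z τ) - annihilation (orb z τ) * H₀)‖ :=
        norm_add_le _ _
    _ ≤ Δ * |t| * 1 + 1 * (Δ * |t|) := by
        refine add_le_add ((norm_mul_le _ _).trans ?_) ((norm_mul_le _ _).trans ?_)
        · exact mul_le_mul (norm_commutator_hopping_creation_le G hΔ t z τ)
            (norm_annihilation_le_one _) (norm_nonneg _) (by positivity)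
        · exact mul_le_mul (norm_creation_le_one _) (norm_commutator_hopping_annihilation_le G hΔ t z τ)
            (norm_nonneg _) zero_le_one
    _ = 2 * Δ * |t| := by ring

/-- `‖1 - n_{zτ}‖ ≤ 1` (`1 - n = c c†` by the CAR). Bratteli–Robinson II §5.2.2. [folklore] -/
theorem norm_one_sub_numberOp_le_one (z : Λ) (τ : Fin 2) :
    ‖(1 : Matrix (Finset (Orb Λ)) (Finset (Orb Λ)) ℂ) - numberOp z τ‖ ≤ 1 := by
  have hcar := annihilation_mul_creation_add_creation_mul_annihilation_holds (ι := Orb Λ)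
    (orb z τ) (orb z τ)
  rw [if_pos rfl] at hcar
  have h1 : (1 : Matrix (Finset (Orb Λ)) (Finset (Orb Λ)) ℂ) - numberOp z τ =
      annihilation (orb z τ) * creation (orb z τ) := by
    rw [numberOp, ← hcar, add_sub_cancel_right]
  rw [h1]
  exact (norm_mul_le _ _).trans (mul_le_one₀ (norm_annihilation_le_one _) (norm_nonneg _)
    (norm_creation_le_one _))

/-- **The commutator of `H` with the projected creation operator is a pure hopping commutator of norm
`≤ 3Δ|t|`, for every real `U`**: `[H, (1-n_{zτ'})c†_{zτ}] = -[H₀, n_{zτ'}] c†_{zτ} + (1-n_{zτ'})[H₀, c†_{zτ}]`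
with `H₀` the hopping part (the repulsion drops out by `interactionSum_mul_projCreation_sub`).
Tasaki (2020) §9.3, §11.2. [folklore] -/
theorem norm_commutator_hamiltonian_projCreation_le {Δ : ℕ} (hΔ : ∀ x : Λ, #{y | G.Adj x y} ≤ Δ)
    (t U : ℝ) (z : Λ) (τ : Fin 2) :
    ∃ τ' : Fin 2, τ' ≠ τ ∧
      ‖hamiltonian G t U * ((1 - numberOp z τ') * creation (orb z τ)) -
          ((1 - numberOp z τ') * creation (orb z τ)) * hamiltonian G t U‖ ≤ 3 * Δ * |t| := by
  obtain ⟨τ', hτ', hD⟩ := interactionSum_mul_projCreation_sub (Λ := Λ) z τ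
  refine ⟨τ', hτ', ?_⟩
  set H₀ := hamiltonian G t 0 with hH₀
  set D : Matrix (Finset (Orb Λ)) (Finset (Orb Λ)) ℂ := ∑ x : Λ, numberOp x 0 * numberOp x 1 with hDdef
  set P : Matrix (Finset (Orb Λ)) (Finset (Orb Λ)) ℂ := 1 - numberOp z τ' with hP
  set A : Matrix (Finset (Orb Λ)) (Finset (Orb Λ)) ℂ := P * creation (orb z τ) with hA
  -- `H = H₀ + U • D` (tree: `Theorems/BalabanIRBirEveryGroundStateAffine.hamiltonian_eq_add_smul_doublon`,
  -- Summits-side; restated inline)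
  have hHU : hamiltonian G t U = H₀ + (U : ℂ) • D := by
    simp [hamiltonian, hH₀, hDdef]
  have hsplit : hamiltonian G t U * A - A * hamiltonian G t U =
      (H₀ * A - A * H₀) + (U : ℂ) • (D * A - A * D) := by
    rw [hHU, add_mul, mul_add, smul_mul_assoc, mul_smul_comm, smul_sub]
    abel
  rw [hsplit, hD, smul_zero, add_zero]
  have hexp : H₀ * A - A * H₀ =
      -(H₀ * numberOp z τ' - numberOp z τ' * H₀) * creation (orb z τ) +
        P * (H₀ * creation (orb z τ) - creation (orb z τ) * H₀) := by
    rw [hA, hP]; noncomm_ring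
  rw [hexp]
  calc _ ≤ ‖-(H₀ * numberOp z τ' - numberOp z τ' * H₀) * creation (orb z τ)‖ +
          ‖P * (H₀ * creation (orb z τ) - creation (orb z τ) * H₀)‖ := norm_add_le _ _
    _ ≤ 2 * Δ * |t| * 1 + 1 * (Δ * |t|) := by
        refine add_le_add ((norm_mul_le _ _).trans ?_) ((norm_mul_le _ _).trans ?_)
        · rw [norm_neg]
          exact mul_le_mul (norm_commutator_hopping_numberOp_le G hΔ t z τ')
            (norm_creation_le_one _) (norm_nonneg _) (by positivity)
        · exact mul_le_mul (norm_one_sub_numberOp_le_one z τ')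
            (norm_commutator_hopping_creation_le G hΔ t z τ) (norm_nonneg _) zero_le_one
    _ = 3 * Δ * |t| := by ring

/-- Spin-up version with the opposite spin made explicit:
`‖[H, (1 - n_{z↓}) c†_{z↑}]‖ ≤ 3Δ|t|` for every real `U`. Tasaki (2020) §9.3, §11.2. [folklore] -/
theorem norm_commutator_hamiltonian_projCreation_up_le {Δ : ℕ} (hΔ : ∀ x : Λ, #{y | G.Adj x y} ≤ Δ)
    (t U : ℝ) (z : Λ) :
    ‖hamiltonian G t U * ((1 - numberOp z 1) * creation (orb z 0)) -
        ((1 - numberOp z 1) * creation (orb z 0)) * hamiltonian G t U‖ ≤ 3 * Δ * |t| := by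
  obtain ⟨τ', hτ', h⟩ := norm_commutator_hamiltonian_projCreation_le G hΔ t U z 0
  obtain rfl : τ' = 1 := Fin.eq_one_of_ne_zero τ' hτ'
  exact h

end Literature.MathematicalPhysics.QuantumLattice
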